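import Summits.HodgeConjecture.HodgeConjecture.Theorems.F0P3cStCharTSCayleyChartUnitary   -- ★ (C4u) p851894 `exists_cayley_chart_haar`, `exists_levels`; ★ (C4) kit `isOpen_image_chart`, `continuousOn_chart`, `isCompact_level`, `exists_level_subset_of_mem_nhds`, `injOn_chart`
import Summits.HodgeConjecture.HodgeConjecture.Theorems.F0P3cStCharTSNewtonCore           -- ★ FILE 2′ p852029 (F0P2-p01): `depth_chart_of_newtonData`, `newtonData_addSubgroup`
import Literature.Analysis.Calculus.UltrametricNewtonChart                                  -- ★ D1 p851977: `exists_depth_linearNewton_of_hasStrictFDerivAt`, ball filtrations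
import Literature.NumberTheory.Weil1982.CayleySandwichStrictDeriv                           -- (D6a) analytic half (this seat): `hasStrictFDerivAt_cayleySandwich`, `exists_continuousLinearEquiv_sandwichDeriv`, `eventually_isUnit_det_*`, `cayleySandwich_at_zero`
import Literature.NumberTheory.Weil1982.CayleyCentralShift                                  -- (D6c) (this seat): `exists_central_shift`, `skew_sandwichDeriv`, `skew_sandwichDeriv_symm`, `sandwichDeriv_symm_apply`
import Literature.NumberTheory.GaloisRepresentations.LocalFieldFiniteExtension              -- ★ `norm_le_norm_iff_vle`, `completeSpace_∕isUltrametricDist_nontriviallyNormedField` (R1 norm frame)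
import Literature.NumberTheory.Automorphic.AddCharConductorExponent                         -- ★ `normAbs_lt_normAbs_iff` (valuation ↔ `normAbs`)
import Literature.NumberTheory.Automorphic.TateLocalZetaShells                              -- ★ `exists_normAbs_eq_inv` (a non-zero element of valuation `< 1`)
import HarnessLib

/-!
# F0 · P3c · line LH6 «StCharTS» — ROAD «HC-D» brick (D6a)+(D6c): THE CAYLEY CHART AT AN ARBITRARY POINT `g₀` OF THE UNITARY GROUP READS HAAR
# MEASURE AS ADDITIVE HAAR MEASURE OF THE LIE ALGEBRA, LINEARLY: `∫_{g₀·c(Λ_k)} H dν = κ_k · ∫_{Λ_k} H(z·c(X₀ + L̃ Y)) dμ(Y)`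

Cell `pub/hodgecm-mathlib`, crux H413 = `stmt-HodgeConjecture-24833` (lane `--supports … --as helper`); seat F0P3a-p06 (g21); ROAD «HC-D» (holder ∕ dealer
F0P2-p01 (g23): the in-house pay-down of RUNG0's named input `hDGliO` = (HC-D) «`|D_G|^{−1∕2} ∈ L¹_loc(G)`» [HarishChandra1970 VII §1 Thm. 15]),
bricks (D6a) «CAYLEY CHART AT ARBITRARY `X₀`» + (D6c) «CENTRAL SHIFT» (DEAL #2 2026-09-02T16:11Z), in the road's letters R1–R5 (16:24Z):
`K` a non-archimedean local field with `2 ≠ 0`, `σ : K →+* K`, `J`, the Lie algebra an ARBITRARY `𝔲 : AddSubgroup (Matrix m m K)` with field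
hypothesis `h𝔲 : X ∈ 𝔲 ↔ ᵗ(σX) J + J X = 0`, its additive Haar measure `μ`; the group ABSTRACTLY as ★ (C4u): `ρ : G →* GL m K` inducing, injective,
`range ρ = {unitary}`, Haar measure `ν`; norms only INSIDE PROOFS (`letI := IsNonarchimedeanLocalField.nontriviallyNormedField K` + elementwise sup norm
on matrices, R1).  THEOREMS ONLY; sorry-free; no definition ∕ instance ∕ notation ∕ named fact.

THE MATHEMATICS (the step (G→𝔤) of the HC-D census `F0/P2/p01/g23/CENSUS-HCD.v1.F0P2p01g23.md` §1; [Serre1992LALG] Part II Ch. IV §8–§9,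
[PlatonovRapinchuk1994] §3.3, [Schikhof1984] §27).  Fix `g₀ ∈ G`.
(D6c) CENTRAL SHIFT (★ `exists_central_shift`): the norm-one scalars `{z | σ z · z = 1}` being infinite, `ρ g₀ = z • c(X₀)` with `X₀ ∈ 𝔲`, `1 ± X₀` invertible.
(D6a) GROUP HALF (§2, ★ (C4u) at radius `α`): the Cayley chart `c : 𝔲 ⊇ Λ → G` carries `μ|_Λ` to a constant multiple of `ν|_{c(Λ)}`, and `ν` is left
invariant, so `∫⁻_{g₀·c(Λ)} H(ρ y) dν(y) = (ν(cΛ)∕μ(Λ)) · ∫⁻_Λ H(ρ g₀ · c(Y)) dμ(Y)`; and `ρ g₀ · c(Y) = z · c(X₀) c(Y) = z · c(S(X₀, Y))` (★ (C2)).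
LIE HALF (§3): `Y ↦ S(X₀, Y)` has strict derivative `L̃ : Y ↦ (1 + X₀) Y (1 − X₀)` at `0` (★ `hasStrictFDerivAt_cayleySandwich`), an automorphism of `M_m(K)`
preserving `𝔲` in both directions (★ `skew_sandwichDeriv{,_symm}`); ★ D1 turns this into NEWTON DATA for the ball filtration, ★ FILE 2′ §2 descends the data
to `𝔲` and ★ FILE 2′ §1 integrates it: `∫⁻_{Λ_k} f(S(X₀,Y) − X₀) dμ = ∫⁻_{Λ_k} f(L̃ Y) dμ` for `k ≥ k₀`.
HEAD (§4) **`exists_depth_lintegral_translate_eq`**: for every `g₀` there are `z`, `X₀ ∈ 𝔲`, `L̃ ∈ Aut(𝔲)` (as `≃ₜ+`, with `↑(L̃ Y) = (1 + X₀) ↑Y (1 − X₀)`), a ball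
filtration `Λ` of `𝔲` and a depth `k₀` such that for all `k ≥ k₀` there is an OPEN `U ∋ g₀` with, for every `H : M_m(K) → [0,∞]` (measurable along `ρ` and
along the chart), **`∫⁻_{U} H(ρ g) dν(g) = κ_k · ∫⁻_{Λ_k} H(z • cayley(X₀ + ↑(L̃ Y))) dμ(Y)`**, `0 < κ_k < ∞`.  The consumer `F0P3cStCharTSHCDGroupToLie` puts
`H := θ` (the `G`-side integrand of `hDGliO`, R2) and reads `θ(z • cayley X) ≍ ηι(X)` off ★ D6(b) `CayleyCharpolyDiscr`.
HONEST LABEL: count-neutral; closes no organ; HC_CM is proved only modulo the 7 printed citations (2 remaining: hLiu418 = `stmt-HodgeConjecture-24832`,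
h413 = `stmt-HodgeConjecture-24833`) until rung 0 closes.

## References
* [HarishChandra1970] Harish-Chandra, *Harmonic analysis on reductive p-adic groups*, LNM 162 (1970), Part VII §1 Thm. 15.
* [Serre1992LALG] J.-P. Serre, *Lie Algebras and Lie Groups*, LNM 1500 (1992), Part II Ch. IV §8–§9.
* [PlatonovRapinchuk1994] V. Platonov, A. Rapinchuk, *Algebraic Groups and Number Theory* (1994), §3.3.
* [Schikhof1984] W. H. Schikhof, *Ultrametric Calculus* (1984), §27.
-/

set_option autoImplicit false
set_option linter.dupNamespace false

noncomputable section

open Set Filter MeasureTheory MeasureTheory.Measure TopologicalSpace Topology Matrix ValuativeRel Metric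
open Literature.NumberTheory.Automorphic Literature.NumberTheory.Weil1982.UnitaryFinTopForm
open Literature.NumberTheory.GaloisRepresentations.IsNonarchimedeanLocalField
open Literature.Analysis.Calculus
open Summit.HodgeConjecture.HodgeConjecture.Cruxes.H413.F0P3cStCharTSCayleyChartHaar
open Summit.HodgeConjecture.HodgeConjecture.Cruxes.H413.F0P3cStCharTSCayleyChartUnitary
open Summit.HodgeConjecture.HodgeConjecture.Cruxes.H413.F0P3cStCharTSNewtonCore
open scoped Pointwise Topology ENNReal NNReal MatrixGroups

namespace Summit.HodgeConjecture.HodgeConjecture.Cruxes.H413.F0P3cStCharTSHCDCayleyChartAt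

/-! ## §0 The Lie algebra `𝔲` as a carrier for ★ (C4u): closed embedding, range descriptions -/

section Carrier

variable {K : Type*} [Field K] [ValuativeRel K] [TopologicalSpace K] [IsNonarchimedeanLocalField K]
  {m : Type*} [Fintype m] [DecidableEq m]
  (σ : K →+* K) (J : Matrix m m K) (𝔲 : AddSubgroup (Matrix m m K))

omit [DecidableEq m] in
/-- `𝔲 = {X | ᵗ(σX)·J + J·X = 0}` is closed in `M_m(K)` (`σ` continuous), so its inclusion is a closed embedding. [cite: Serre1992LALG, Part II Ch. IV §9] -/
theorem isClosedEmbedding_subtype (hσ : Continuous σ) (h𝔲 : ∀ X, X ∈ 𝔲 ↔ (X.map σ)ᵀ * J + J * X = 0) :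
    IsClosedEmbedding (𝔲.subtype : 𝔲 → Matrix m m K) := by
  haveI : T2Space K := (isLocalField K).toT2Space
  refine ⟨IsEmbedding.subtypeVal, ?_⟩
  have hrange : Set.range (𝔲.subtype : 𝔲 → Matrix m m K) = {X | (X.map σ)ᵀ * J + J * X = 0} := by
    ext X
    constructor
    · rintro ⟨Y, rfl⟩; exact (h𝔲 _).1 Y.2
    · intro hX; exact ⟨⟨X, (h𝔲 X).2 hX⟩, rfl⟩
  rw [hrange]
  have hc : Continuous fun X : Matrix m m K => (X.map σ)ᵀ * J + J * X :=
    ((continuous_id.matrix_map hσ).matrix_transpose.mul continuous_const).add (continuous_const.mul continuous_id)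
  exact isClosed_eq hc continuous_const

omit [ValuativeRel K] [TopologicalSpace K] [IsNonarchimedeanLocalField K] in
/-- Range description of `𝔲.subtype` in ★ (C4u)'s letters (with `x = 1`). [cite: PlatonovRapinchuk1994, §3.3] -/
theorem range_subtype_iff (h𝔲 : ∀ X, X ∈ 𝔲 ↔ (X.map σ)ᵀ * J + J * X = 0) (X : Matrix m m K) :
    X ∈ Set.range (𝔲.subtype : 𝔲 → Matrix m m K) ↔ ((X.map σ)ᵀ * J + J * X = 0 ∧ X * 1 = 1 * X) := by
  constructor
  · rintro ⟨Y, rfl⟩; exact ⟨(h𝔲 _).1 Y.2, by rw [Matrix.mul_one, Matrix.one_mul]⟩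
  · rintro ⟨hX, -⟩; exact ⟨⟨X, (h𝔲 X).2 hX⟩, rfl⟩

end Carrier

/-! ## §1 The ★ (C4u) levels of `𝔲` are the closed balls of the elementwise valuation norm -/

section Levels

open scoped Matrix.Norms.Elementwise

variable {K : Type*} [Field K] [ValuativeRel K] [TopologicalSpace K] [IsNonarchimedeanLocalField K]
  {m : Type*} [Fintype m] [DecidableEq m] (𝔲 : AddSubgroup (Matrix m m K))

omit [DecidableEq m] in
/-- **Valuation boxes are norm balls**: for `ϖ ∈ K` and the valuation norm of R1 (`nontriviallyNormedField K`, elementwise on matrices, restricted to `𝔲`),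
`ValBound (v(ϖ)^(j+1)) ↑Y ↔ ‖Y‖ ≤ ‖ϖ‖·‖ϖ‖^j` (★ `norm_le_norm_iff_vle`). [cite: Serre1992LALG, Part II Ch. IV §9] -/
theorem coe_level_eq_closedBall {Λ : ℕ → AddSubgroup 𝔲} (ϖ : K)
    (hΛ : ∀ j (Y : 𝔲), Y ∈ Λ j ↔ ValBound (valuation K ϖ ^ (j + 1)) ((𝔲.subtype : 𝔲 →+ Matrix m m K) Y)) (j : ℕ) :
    letI := nontriviallyNormedField K
    (Λ j : Set 𝔲) = closedBall (0 : 𝔲) (‖ϖ‖ * ‖ϖ‖ ^ j) := by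
  letI := nontriviallyNormedField K
  ext Y
  rw [SetLike.mem_coe, hΛ, mem_closedBall_zero_iff, AddSubgroup.coe_norm, ← pow_succ', ← norm_pow,
    Matrix.norm_le_iff (norm_nonneg _)]
  refine forall_congr' fun i => forall_congr' fun l => ?_
  rw [AddSubgroup.coe_subtype, norm_le_norm_iff_vle, Valuation.Compatible.vle_iff_le (v := valuation K), map_pow]

end Levels

/-! ## §2 GROUP HALF: a left translate of the chart window integrates against additive Haar measure of the Lie algebra -/

section GroupHalf

variable {K : Type*} [Field K] [ValuativeRel K] [TopologicalSpace K] [IsNonarchimedeanLocalField K]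
  {m : Type*} [Fintype m] [DecidableEq m]
  {V : Type*} [AddCommGroup V] [TopologicalSpace V] [MeasurableSpace V] [BorelSpace V]
  {G : Type*} [Group G] [TopologicalSpace G] [IsTopologicalGroup G] [MeasurableSpace G] [BorelSpace G]
  (ι : V →+ Matrix m m K) (Λ : ℕ → AddSubgroup V) (ρ : G →* GL m K) (c : V → G)
  (μ : Measure V) (ν : Measure G) [ν.IsMulLeftInvariant]

omit [IsTopologicalGroup G] in
/-- Left translation inside a set integral for a left-invariant measure: `∫⁻_{g • S} F dν = ∫⁻_S F(g·) dν`. [cite: Serre1992LALG, Part II Ch. IV §9] -/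
theorem setLIntegral_smul_eq [MeasurableMul G] [ContinuousConstSMul G G] {S : Set G} (hS : IsOpen S) (g : G) (F : G → ℝ≥0∞) :
    ∫⁻ y in g • S, F y ∂ν = ∫⁻ y in S, F (g * y) ∂ν := by
  have hgS : MeasurableSet (g • S) := (hS.smul g).measurableSet
  rw [← lintegral_indicator hgS, ← lintegral_indicator hS.measurableSet,
    ← lintegral_mul_left_eq_self (μ := ν) (fun y => (g • S).indicator F y) g]
  refine lintegral_congr fun y => ?_
  by_cases hy : y ∈ S
  · have h : g * y ∈ g • S := Set.smul_mem_smul_set_iff.2 hy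
    rw [Set.indicator_of_mem h, Set.indicator_of_mem hy]
  · have h : g * y ∉ g • S := fun h => hy (Set.smul_mem_smul_set_iff.1 h)
    rw [Set.indicator_of_notMem h, Set.indicator_of_notMem hy]

omit [IsNonarchimedeanLocalField K] [ValuativeRel K] [TopologicalSpace K] in
/-- **GROUP HALF.**  If the chart `c` carries `μ|_{Λ₀}` to `κ • ν|_{c(Λ₀)}` (★ (C4u) `exists_cayley_chart_haar`) and `ρ (c X) = cayley (ι X)` on `Λ₀`, then for
every `g₀ ∈ G` and every `H : M_m(K) → [0, ∞]` measurable along `ρ`: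
`∫⁻_{g₀ • c(Λ₀)} H(ρ y) dν(y) = κ⁻¹ · ∫⁻_{Λ₀} H(ρ g₀ · cayley(ι X)) dμ(X)` (left invariance of `ν`, then the push-forward identity).
[cite: Serre1992LALG, Part II Ch. IV §9] [cite: PlatonovRapinchuk1994, §3.3] -/
theorem setLIntegral_translate_chart_eq [ContinuousConstSMul G G] (hΛo : IsOpen (Λ 0 : Set V))
    (hc : ∀ X ∈ Λ 0, ((ρ (c X) : GL m K) : Matrix m m K) = cayley (ι X))
    (hcc : ContinuousOn c (Λ 0 : Set V)) (hco : IsOpen (c '' (Λ 0 : Set V)))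
    {κ : ℝ≥0∞} (hmap : (μ.restrict (Λ 0 : Set V)).map c = κ • ν.restrict (c '' (Λ 0 : Set V))) (hκ0 : κ ≠ 0) (hκt : κ ≠ ∞)
    (g₀ : G) (H : Matrix m m K → ℝ≥0∞) (hH : Measurable fun g : G => H ((ρ g : GL m K) : Matrix m m K)) :
    ∫⁻ y in g₀ • (c '' (Λ 0 : Set V)), H ((ρ y : GL m K) : Matrix m m K) ∂ν =
      κ⁻¹ * ∫⁻ X in (Λ 0 : Set V), H (((ρ g₀ : GL m K) : Matrix m m K) * cayley (ι X)) ∂μ := by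
  -- left invariance
  have hF : Measurable fun y : G => H ((ρ (g₀ * y) : GL m K) : Matrix m m K) := hH.comp (measurable_const_mul g₀)
  rw [setLIntegral_smul_eq ν hco g₀]
  -- push-forward identity
  have hpush : κ * ∫⁻ y in c '' (Λ 0 : Set V), H ((ρ (g₀ * y) : GL m K) : Matrix m m K) ∂ν =
      ∫⁻ X in (Λ 0 : Set V), H ((ρ (g₀ * c X) : GL m K) : Matrix m m K) ∂μ := by
    rw [← lintegral_map' (hF.aemeasurable) (hcc.aemeasurable hΛo.measurableSet), hmap, lintegral_smul_measure, smul_eq_mul]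
  have hsolve : ∫⁻ y in c '' (Λ 0 : Set V), H ((ρ (g₀ * y) : GL m K) : Matrix m m K) ∂ν =
      κ⁻¹ * ∫⁻ X in (Λ 0 : Set V), H ((ρ (g₀ * c X) : GL m K) : Matrix m m K) ∂μ := by
    rw [← hpush, ← mul_assoc, ENNReal.inv_mul_cancel hκ0 hκt, one_mul]
  rw [hsolve]
  congr 1
  refine setLIntegral_congr_fun hΛo.measurableSet fun X hX => ?_
  rw [map_mul, Units.val_mul, hc X hX]

end GroupHalf

/-! ## §3 LIE HALF and §4 the HEAD: per `g₀`, the translated chart window integrates LINEARLY against `μ` -/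

section Assembly

open scoped Matrix.Norms.Elementwise

variable {K : Type*} [Field K] [ValuativeRel K] [TopologicalSpace K] [IsNonarchimedeanLocalField K]
  {m : Type*} [Fintype m] [DecidableEq m]
  (σ : K →+* K) (J : Matrix m m K) (𝔲 : AddSubgroup (Matrix m m K))

/-- **The chart derivative as a bi-continuous automorphism of `𝔲`**: for `X₀ ∈ 𝔲` with `1 ± X₀` invertible there is `L̃ : 𝔲 ≃ₜ+ 𝔲` with
`↑(L̃ Y) = (1 + X₀) ↑Y (1 − X₀)` (★ `skew_sandwichDeriv`, `skew_sandwichDeriv_symm`, `sandwichDeriv_symm_apply`). [cite: Serre1992LALG, Part II Ch. IV §8] -/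
theorem exists_continuousAddEquiv_sandwichDeriv (h𝔲 : ∀ X, X ∈ 𝔲 ↔ (X.map σ)ᵀ * J + J * X = 0) {X₀ : Matrix m m K} (hX₀ : X₀ ∈ 𝔲)
    (hp : IsUnit (1 + X₀).det) (hm : IsUnit (1 - X₀).det) :
    ∃ LS : 𝔲 ≃ₜ+ 𝔲, ∀ Y : 𝔲, ((LS Y : 𝔲) : Matrix m m K) = (1 + X₀) * (Y : Matrix m m K) * (1 - X₀) := by
  have hX₀s := (h𝔲 X₀).1 hX₀
  refine ⟨{ toFun := fun Y => ⟨(1 + X₀) * (Y : Matrix m m K) * (1 - X₀), (h𝔲 _).2 (skew_sandwichDeriv σ hX₀s ((h𝔲 _).1 Y.2))⟩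
            invFun := fun Y => ⟨(1 + X₀)⁻¹ * (Y : Matrix m m K) * (1 - X₀)⁻¹, (h𝔲 _).2 (skew_sandwichDeriv_symm σ hX₀s ((h𝔲 _).1 Y.2) hp hm)⟩
            left_inv := fun Y => Subtype.ext (sandwichDeriv_symm_apply hp hm (Y : Matrix m m K)).1
            right_inv := fun Y => Subtype.ext (sandwichDeriv_symm_apply hp hm (Y : Matrix m m K)).2
            map_add' := fun Y Z => Subtype.ext (by
              simp only [AddSubgroup.coe_add, AddMemClass.mk_add_mk, Matrix.mul_add, Matrix.add_mul])
            continuous_toFun := ((continuous_const.mul continuous_subtype_val).mul continuous_const).subtype_mk _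
            continuous_invFun := ((continuous_const.mul continuous_subtype_val).mul continuous_const).subtype_mk _ }, fun Y => rfl⟩

variable [MeasurableSpace 𝔲] [BorelSpace 𝔲] (μ : Measure 𝔲) [μ.IsAddHaarMeasure]
  {G : Type*} [Group G] [TopologicalSpace G] [IsTopologicalGroup G] [LocallyCompactSpace G] [SecondCountableTopology G] [T2Space G]
  [MeasurableSpace G] [BorelSpace G] (ρ : G →* GL m K) (ν : Measure G) [ν.IsHaarMeasure]

set_option maxHeartbeats 800000 in
-- one long assembly: the central shift, the chart at depth `k`, the Newton descent and the push-forward identity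
/-- **(D6a)+(D6c) HEAD — THE TRANSLATED CAYLEY CHART INTEGRATES LINEARLY.**  `K` a non-archimedean local field with `2 ≠ 0` and `σ` continuous, `J` invertible,
`𝔲 = {X | ᵗ(σX) J + J X = 0}` with additive Haar measure `μ`, `ρ : G →* GL_m(K)` an inducing injective homomorphism onto the unitary group of `(σ, J)` with
Haar measure `ν`, and infinitely many norm-one scalars.  Then for every `g₀ ∈ G` there are a norm-one `z`, `X₀ ∈ 𝔲` with `1 ± X₀` invertible and
`ρ g₀ = z • cayley X₀` (★ (D6c)), the chart derivative `L̃ : 𝔲 ≃ₜ+ 𝔲`, `↑(L̃ Y) = (1 + X₀) ↑Y (1 − X₀)`, a decreasing filtration `Λ` of `𝔲` by compact open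
subgroups forming a neighbourhood basis of `0`, and a depth `k₀`, such that for every `k ≥ k₀`: `1 ± (X₀ + ↑(L̃ Y))` are invertible on `Λ k`, and there
is an OPEN `U ∋ g₀` and `0 < κ < ∞` with, for every `H : M_m(K) → [0, ∞]` measurable along `ρ` and along `s ↦ z • cayley (X₀ + ↑s)`,
**`∫⁻_U H(ρ g) dν(g) = κ · ∫⁻_{Λ k} H(z • cayley(X₀ + ↑(L̃ Y))) dμ(Y)`**.  (`U = g₀ • c_k(Λ k)` for the Cayley chart of ★ (C4u) at radius `α^{k+1}`;
left invariance + ★ (C4u) push-forward; `ρ g₀ · c(Y) = z · c(S(X₀, Y))` ★ (C2); Newton data of `S(X₀, ·)` from ★ `hasStrictFDerivAt_cayleySandwich` via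
★ D1, descended to `𝔲` and integrated by ★ FILE 2′.) [cite: HarishChandra1970, Part VII §1 Thm. 15] [cite: Serre1992LALG, Part II Ch. IV §9]
[cite: PlatonovRapinchuk1994, §3.3] [cite: Schikhof1984, §27 Lemma 27.4–Thm. 27.5] -/
theorem exists_depth_lintegral_translate_eq (hσc : Continuous σ) (h2 : (2 : K) ≠ 0) (hJ : IsUnit J.det)
    (h𝔲 : ∀ X, X ∈ 𝔲 ↔ (X.map σ)ᵀ * J + J * X = 0)
    (hρ : IsInducing ρ) (hρinj : Function.Injective ρ)
    (hρr : ∀ g : GL m K, g ∈ Set.range ρ ↔ (((g : Matrix m m K)).map σ)ᵀ * J * (g : Matrix m m K) = J)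
    (hE : {z : K | σ z * z = 1}.Infinite) (g₀ : G) :
    ∃ (z : K) (X₀ : Matrix m m K) (LS : 𝔲 ≃ₜ+ 𝔲) (Λ : ℕ → AddSubgroup 𝔲) (k₀ : ℕ),
      σ z * z = 1 ∧ z ≠ 0 ∧ X₀ ∈ 𝔲 ∧ IsUnit (1 - X₀).det ∧ IsUnit (1 + X₀).det ∧
      ((ρ g₀ : GL m K) : Matrix m m K) = z • cayley X₀ ∧
      (∀ Y : 𝔲, ((LS Y : 𝔲) : Matrix m m K) = (1 + X₀) * (Y : Matrix m m K) * (1 - X₀)) ∧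
      (∀ j, IsOpen (Λ j : Set 𝔲)) ∧ (∀ j, IsCompact (Λ j : Set 𝔲)) ∧ Antitone Λ ∧ (∀ W ∈ 𝓝 (0 : 𝔲), ∃ j, (Λ j : Set 𝔲) ⊆ W) ∧
      ∀ k, k₀ ≤ k →
        (∀ Y ∈ Λ k, IsUnit (1 - (X₀ + ((LS Y : 𝔲) : Matrix m m K))).det ∧ IsUnit (1 + (X₀ + ((LS Y : 𝔲) : Matrix m m K))).det) ∧
        ∃ U : Set G, IsOpen U ∧ g₀ ∈ U ∧ ∃ κ : ℝ≥0∞, κ ≠ 0 ∧ κ ≠ ∞ ∧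
          ∀ H : Matrix m m K → ℝ≥0∞, Measurable (fun g : G => H ((ρ g : GL m K) : Matrix m m K)) →
            Measurable (fun s : 𝔲 => H (z • cayley (X₀ + (s : Matrix m m K)))) →
            ∫⁻ g in U, H ((ρ g : GL m K) : Matrix m m K) ∂ν =
              κ * ∫⁻ Y in (Λ k : Set 𝔲), H (z • cayley (X₀ + ((LS Y : 𝔲) : Matrix m m K))) ∂μ := by
  classical
  haveI : T2Space K := (isLocalField K).toT2Space
  have hLC : LocallyCompactSpace (Matrix m m K) := inferInstanceAs (LocallyCompactSpace (m → m → K))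
  have hBor : BorelSpace 𝔲 := inferInstance
  haveI : SecondCountableTopology K := secondCountableTopology_localField K
  haveI : SecondCountableTopology (Matrix m m K) := inferInstanceAs (SecondCountableTopology (m → m → K))
  haveI hSC : SecondCountableTopology 𝔲 := TopologicalSpace.Subtype.secondCountableTopology _
  have hFin : IsFiniteMeasureOnCompacts μ := inferInstance
  -- R1 norm frame (inside the proof only)
  letI : NontriviallyNormedField K := nontriviallyNormedField K
  haveI : CompleteSpace K := completeSpace_nontriviallyNormedField K
  haveI : IsUltrametricDist K := isUltrametricDist_nontriviallyNormedField K
  -- the carrier `𝔲`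
  have hι : IsClosedEmbedding (𝔲.subtype : 𝔲 → Matrix m m K) := isClosedEmbedding_subtype σ J 𝔲 hσc h𝔲
  have hιr := range_subtype_iff σ J 𝔲 h𝔲
  have hρr' : ∀ g : GL m K, g ∈ Set.range ρ ↔
      ((((g : Matrix m m K)).map σ)ᵀ * J * (g : Matrix m m K) = J ∧ (g : Matrix m m K) * 1 = 1 * (g : Matrix m m K)) := fun g => by
    rw [hρr, Matrix.mul_one, Matrix.one_mul]; exact ⟨fun h => ⟨h, rfl⟩, fun h => h.1⟩
  haveI : IsUltrametricDist (Matrix m m K) := inferInstanceAs (IsUltrametricDist (m → m → K))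
  haveI : ProperSpace (Matrix m m K) := @ProperSpace.of_locallyCompactSpace K _ (Matrix m m K) _ _ hLC
  have h𝔲cl : IsClosed ((𝔲 : Set (Matrix m m K))) := by
    have := hι.isClosed_range
    rwa [AddSubgroup.coe_subtype, Subtype.range_coe_subtype] at this
  haveI : ProperSpace 𝔲 := ProperSpace.of_isClosed h𝔲cl
  have h2u : IsUnit (2 : K) := isUnit_iff_ne_zero.2 h2
  -- (D6c) the central shift of `ρ g₀`
  have hU0 : ((((ρ g₀ : GL m K) : Matrix m m K)).map σ)ᵀ * J * ((ρ g₀ : GL m K) : Matrix m m K) = J := (hρr _).1 ⟨g₀, rfl⟩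
  obtain ⟨z, X₀, hz1, hz0, hX₀s, -, hm, hp, hg₀⟩ :=
    exists_central_shift σ h2 hJ hU0 (show ((ρ g₀ : GL m K) : Matrix m m K) * 1 = 1 * _ by rw [Matrix.mul_one, Matrix.one_mul]) hE
  have hX₀ : X₀ ∈ 𝔲 := (h𝔲 X₀).2 hX₀s
  -- the chart derivative on `𝔲` and on `M_m(K)`
  obtain ⟨LS, hLS⟩ := exists_continuousAddEquiv_sandwichDeriv σ J 𝔲 h𝔲 hX₀ hp hm
  obtain ⟨e, he, -, hecoe⟩ := exists_continuousLinearEquiv_sandwichDeriv (𝕜 := K) hm hp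
  -- a scalar `ϖ` with `0 < |ϖ| < 1`; the radius `α = v(ϖ)`; the levels of `𝔲`
  obtain ⟨ϖ, hϖ0, hϖn⟩ := exists_normAbs_eq_inv (F := K)
  have hα0 : valuation K ϖ ≠ 0 := (Valuation.ne_zero_iff _).2 hϖ0
  have hα1 : valuation K ϖ < 1 := by
    have h : normAbs K ϖ < normAbs K 1 := by rw [hϖn, map_one]; exact inv_residueFieldCard_lt_one
    rwa [normAbs_lt_normAbs_iff, map_one] at h
  obtain ⟨Λ, hΛ⟩ := exists_levels (𝔲.subtype : 𝔲 →+ Matrix m m K) (valuation K ϖ) (V := 𝔲)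
  have hΛball : ∀ j, (Λ j : Set 𝔲) = closedBall (0 : 𝔲) (‖ϖ‖ * ‖ϖ‖ ^ j) := coe_level_eq_closedBall 𝔲 ϖ hΛ
  have hr : 0 < ‖ϖ‖ := norm_pos_iff.2 hϖ0
  have hγ1 : ‖ϖ‖ < 1 := (norm_lt_one_iff (F := K) ϖ).2 hα1
  have hΛo : ∀ j, IsOpen (Λ j : Set 𝔲) := isOpen_level (𝔲.subtype : 𝔲 →+ Matrix m m K) Λ hι.continuous hΛ hα0
  have hΛc : ∀ j, IsCompact (Λ j : Set 𝔲) := isCompact_level (𝔲.subtype : 𝔲 →+ Matrix m m K) Λ hι hΛ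
  have hΛanti : Antitone Λ := level_antitone (𝔲.subtype : 𝔲 →+ Matrix m m K) Λ hΛ hα1.le
  have hΛbasis : ∀ W ∈ 𝓝 (0 : 𝔲), ∃ j, (Λ j : Set 𝔲) ⊆ W :=
    exists_level_subset_of_mem_nhds (𝔲.subtype : 𝔲 →+ Matrix m m K) Λ hι hΛ hα1
  -- the modified sandwich `φ₀` (equal to `S(X₀, ·)` near `0`, and `𝔲`-valued up to `X₀` everywhere)
  set φ₀ : Matrix m m K → Matrix m m K := fun Y =>
    if IsUnit (1 + X₀ * Y).det ∧ IsUnit (1 - Y).det then (1 - X₀)⁻¹ * (X₀ + Y) * (1 + X₀ * Y)⁻¹ * (1 - X₀) else X₀ with hφ₀def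
  have hφ₀good : ∀ Y, IsUnit (1 + X₀ * Y).det → IsUnit (1 - Y).det → φ₀ Y = (1 - X₀)⁻¹ * (X₀ + Y) * (1 + X₀ * Y)⁻¹ * (1 - X₀) :=
    fun Y h1 h2 => by rw [hφ₀def]; exact if_pos ⟨h1, h2⟩
  have hφ₀0 : φ₀ 0 = X₀ := by
    rw [hφ₀good 0 (by rw [mul_zero, add_zero, Matrix.det_one]; exact isUnit_one) (by rw [sub_zero, Matrix.det_one]; exact isUnit_one)]
    exact cayleySandwich_at_zero hm
  have hφ₀ev : (fun Y : Matrix m m K => (1 - X₀)⁻¹ * (X₀ + Y) * (1 + X₀ * Y)⁻¹ * (1 - X₀)) =ᶠ[𝓝 0] φ₀ := by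
    filter_upwards [eventually_isUnit_det_one_add_mul X₀, eventually_isUnit_det_one_sub (K := K) (n := m)] with Y h1 h2
    exact (hφ₀good Y h1 h2).symm
  have hderiv : HasStrictFDerivAt φ₀ (e : Matrix m m K →L[K] Matrix m m K) 0 := by
    rw [hecoe]
    exact (hasStrictFDerivAt_cayleySandwich (𝕜 := K) hm).congr_of_eventuallyEq hφ₀ev
  -- ambient NEWTON DATA (★ D1), then DESCENT to `𝔲` (★ FILE 2′ §2)
  obtain ⟨k₁, hN⟩ := exists_depth_linearNewton_of_hasStrictFDerivAt e hderiv hr hr hγ1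
  let eA : Matrix m m K ≃ₜ+ Matrix m m K :=
    { e.toLinearEquiv.toAddEquiv with continuous_toFun := e.continuous, continuous_invFun := e.symm.continuous }
  have heA : ∀ Y, eA Y = e Y := fun Y => rfl
  have hLSe : ∀ s : 𝔲, ((LS s : 𝔲) : Matrix m m K) = eA s := fun s => by rw [heA, he, hLS]
  have hφS : ∀ s : 𝔲, φ₀ (0 + s) - φ₀ 0 ∈ 𝔲 := by
    intro s
    rw [zero_add, hφ₀0]
    by_cases hgood : IsUnit (1 + X₀ * (s : Matrix m m K)).det ∧ IsUnit (1 - (s : Matrix m m K)).det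
    · rw [hφ₀good _ hgood.1 hgood.2]
      exact 𝔲.sub_mem ((h𝔲 _).2 (transpose_map_cayleySandwich_add_eq_zero σ h2u hm hgood.2 hgood.1 hX₀s ((h𝔲 _).1 s.2))) hX₀
    · have : φ₀ s = X₀ := by rw [hφ₀def]; exact if_neg hgood
      rw [this, sub_self]; exact 𝔲.zero_mem
  have hN0 : ∀ k, k₁ ≤ k → ∀ j, k ≤ j → ∀ x ∈ closedBall (0 : Matrix m m K) (‖ϖ‖ * ‖ϖ‖ ^ k),
      ∀ y ∈ closedBall (0 : Matrix m m K) (‖ϖ‖ * ‖ϖ‖ ^ j),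
        φ₀ (0 + (x + y)) - φ₀ (0 + x) - eA y ∈ (eA : Matrix m m K → Matrix m m K) '' closedBall (0 : Matrix m m K) (‖ϖ‖ * ‖ϖ‖ ^ (j + 1)) := by
    intro k hk j hj x hx y hy
    have hfun : (eA : Matrix m m K → Matrix m m K) = (e : Matrix m m K → Matrix m m K) := funext heA
    rw [hfun]
    exact hN k hk j hj x hx y hy
  have hNS := newtonData_addSubgroup 𝔲 𝔲 φ₀ 0 eA LS hLSe hφS hN0
  -- the chart package on `𝔲` (★ FILE 2′ §1); the Borel ∕ finiteness instances are those of the given topology (same topology, passed explicitly)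
  have hchart := @depth_chart_of_newtonData 𝔲 _ _ _ _ hBor 𝔲 _ _ hBor μ hFin _
    (fun s : 𝔲 => (⟨φ₀ (0 + s) - φ₀ 0, hφS s⟩ : 𝔲)) 0 LS Λ _ _ hΛball hr hr hγ1 k₁ hNS
  -- the «good» depth: sandwich defined, `1 ± (X₀ + L̃ Y)` invertible
  have hgoodnhds : {Y : 𝔲 | IsUnit (1 + X₀ * (Y : Matrix m m K)).det ∧ IsUnit (1 - (Y : Matrix m m K)).det ∧
      IsUnit (1 - (X₀ + ((LS Y : 𝔲) : Matrix m m K))).det ∧ IsUnit (1 + (X₀ + ((LS Y : 𝔲) : Matrix m m K))).det} ∈ 𝓝 (0 : 𝔲) := by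
    have hc0 : Continuous fun Y : 𝔲 => (Y : Matrix m m K) := continuous_subtype_val
    have hcL : Continuous fun Y : 𝔲 => ((LS Y : 𝔲) : Matrix m m K) := continuous_subtype_val.comp LS.continuous
    have h1 : ∀ᶠ Y : 𝔲 in 𝓝 0, IsUnit (1 + X₀ * (Y : Matrix m m K)).det := by
      have hc : Continuous fun Y : 𝔲 => (1 + X₀ * (Y : Matrix m m K)).det := (continuous_const.add (continuous_const.mul hc0)).matrix_det
      have hval : (1 + X₀ * ((0 : 𝔲) : Matrix m m K)).det ≠ 0 := by simp
      filter_upwards [(isOpen_ne_fun hc continuous_const).mem_nhds hval] with Y hY using isUnit_iff_ne_zero.2 hY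
    have h2' : ∀ᶠ Y : 𝔲 in 𝓝 0, IsUnit (1 - (Y : Matrix m m K)).det := by
      have hc : Continuous fun Y : 𝔲 => (1 - (Y : Matrix m m K)).det := (continuous_const.sub hc0).matrix_det
      have hval : (1 - ((0 : 𝔲) : Matrix m m K)).det ≠ 0 := by simp
      filter_upwards [(isOpen_ne_fun hc continuous_const).mem_nhds hval] with Y hY using isUnit_iff_ne_zero.2 hY
    have h3 : ∀ᶠ Y : 𝔲 in 𝓝 0, IsUnit (1 - (X₀ + ((LS Y : 𝔲) : Matrix m m K))).det := by
      have hc : Continuous fun Y : 𝔲 => (1 - (X₀ + ((LS Y : 𝔲) : Matrix m m K))).det := (continuous_const.sub (continuous_const.add hcL)).matrix_det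
      have hval : (1 - (X₀ + ((LS 0 : 𝔲) : Matrix m m K))).det ≠ 0 := by
        rw [map_zero, ZeroMemClass.coe_zero, add_zero]; exact hm.ne_zero
      filter_upwards [(isOpen_ne_fun hc continuous_const).mem_nhds hval] with Y hY using isUnit_iff_ne_zero.2 hY
    have h4 : ∀ᶠ Y : 𝔲 in 𝓝 0, IsUnit (1 + (X₀ + ((LS Y : 𝔲) : Matrix m m K))).det := by
      have hc : Continuous fun Y : 𝔲 => (1 + (X₀ + ((LS Y : 𝔲) : Matrix m m K))).det := (continuous_const.add (continuous_const.add hcL)).matrix_det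
      have hval : (1 + (X₀ + ((LS 0 : 𝔲) : Matrix m m K))).det ≠ 0 := by
        rw [map_zero, ZeroMemClass.coe_zero, add_zero]; exact hp.ne_zero
      filter_upwards [(isOpen_ne_fun hc continuous_const).mem_nhds hval] with Y hY using isUnit_iff_ne_zero.2 hY
    filter_upwards [h1, h2', h3, h4] with Y a b c d using ⟨a, b, c, d⟩
  obtain ⟨k₂, hk₂⟩ := hΛbasis _ hgoodnhds
  -- OUTPUT
  refine ⟨z, X₀, LS, Λ, max k₁ k₂, hz1, hz0, hX₀, hm, hp, hg₀, hLS, hΛo, hΛc, hΛanti, hΛbasis, fun k hk => ?_⟩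
  have hk₁ : k₁ ≤ k := le_trans (le_max_left _ _) hk
  have hgoodk : (Λ k : Set 𝔲) ⊆ {Y : 𝔲 | IsUnit (1 + X₀ * (Y : Matrix m m K)).det ∧ IsUnit (1 - (Y : Matrix m m K)).det ∧
      IsUnit (1 - (X₀ + ((LS Y : 𝔲) : Matrix m m K))).det ∧ IsUnit (1 + (X₀ + ((LS Y : 𝔲) : Matrix m m K))).det} :=
    fun Y hY => hk₂ (hΛanti (le_trans (le_max_right _ _) hk) hY)
  refine ⟨fun Y hY => ⟨(hgoodk hY).2.2.1, (hgoodk hY).2.2.2⟩, ?_⟩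
  -- ★ (C4u) at radius `α^(k+1)`
  have hαk0 : valuation K ϖ ^ (k + 1) ≠ 0 := pow_ne_zero _ hα0
  have hαk1 : valuation K ϖ ^ (k + 1) < 1 := pow_lt_one₀ zero_le hα1 (Nat.succ_ne_zero k)
  have hv2 : valuation K 2 ≠ 0 := (Valuation.ne_zero_iff _).2 h2
  have hβ0 : valuation K 2 * valuation K ϖ ^ (k + 1) ≠ 0 := mul_ne_zero hv2 hαk0
  have hβ : valuation K 2 * valuation K ϖ ^ (k + 1) < valuation K 2 := mul_lt_of_lt_one_right (zero_lt_iff.2 hv2) hαk1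
  obtain ⟨Λ', c', σV', hΛ', hc', hσ', hσ'c, hwin', hmap', -⟩ :=
    exists_cayley_chart_haar σ J 1 (𝔲.subtype : 𝔲 →+ Matrix m m K) ρ μ ν hι hρ hρinj hιr hρr' hαk0 hαk1 hβ0 hβ le_rfl
  have hΛ'eq : (Λ' 0 : Set 𝔲) = (Λ k : Set 𝔲) := by
    ext Y; rw [SetLike.mem_coe, SetLike.mem_coe, hΛ', hΛ, zero_add, pow_one]
  have hΛ'o : IsOpen (Λ' 0 : Set 𝔲) := hΛ'eq ▸ hΛo k
  have hc'c : ContinuousOn c' (Λ' 0 : Set 𝔲) := continuousOn_chart (𝔲.subtype : 𝔲 →+ Matrix m m K) Λ' ρ c' hι.continuous hΛ' hαk1 hρ hc'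
  have hc'o : IsOpen (c' '' (Λ' 0 : Set 𝔲)) :=
    isOpen_image_chart (𝔲.subtype : 𝔲 →+ Matrix m m K) Λ' ρ c' σV' hι hΛ' hαk0 hαk1 hρ hρinj hc' hσ' hσ'c hβ0 hwin'
  -- the constant
  have hμpos : μ (Λ' 0 : Set 𝔲) ≠ 0 := ((hΛ'o).measure_pos μ ⟨0, (Λ' 0).zero_mem⟩).ne'
  have hμfin : μ (Λ' 0 : Set 𝔲) ≠ ∞ := (hΛ'eq ▸ (hΛc k)).measure_lt_top.ne
  have hνpos : ν (c' '' (Λ' 0 : Set 𝔲)) ≠ 0 := (hc'o.measure_pos ν ⟨c' 0, Set.mem_image_of_mem _ (Λ' 0).zero_mem⟩).ne'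
  have hνfin : ν (c' '' (Λ' 0 : Set 𝔲)) ≠ ∞ := ((hΛ'eq ▸ hΛc k).image_of_continuousOn hc'c).measure_lt_top.ne
  have hκ0 : μ (Λ' 0 : Set 𝔲) / ν (c' '' (Λ' 0 : Set 𝔲)) ≠ 0 := ENNReal.div_ne_zero.2 ⟨hμpos, hνfin⟩
  have hκt : μ (Λ' 0 : Set 𝔲) / ν (c' '' (Λ' 0 : Set 𝔲)) ≠ ∞ := ENNReal.div_ne_top hμfin hνpos
  -- `c' 0 = 1`, so `g₀ ∈ g₀ • c'(Λ' 0)`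
  have hc'0 : c' 0 = 1 := hρinj (Units.ext (by rw [hc' 0 (Λ' 0).zero_mem, map_zero, map_one, Units.val_one, cayley_def]; simp))
  refine ⟨g₀ • (c' '' (Λ' 0 : Set 𝔲)), hc'o.smul g₀,
    ⟨c' 0, Set.mem_image_of_mem _ (Λ' 0).zero_mem, show g₀ • c' 0 = g₀ by rw [hc'0, smul_eq_mul, mul_one]⟩,
    (μ (Λ' 0 : Set 𝔲) / ν (c' '' (Λ' 0 : Set 𝔲)))⁻¹, ENNReal.inv_ne_zero.2 hκt, ENNReal.inv_ne_top.2 hκ0, fun H hH₁ hH₂ => ?_⟩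
  -- GROUP HALF
  rw [setLIntegral_translate_chart_eq (𝔲.subtype : 𝔲 →+ Matrix m m K) Λ' ρ c' μ ν hΛ'o hc' hc'c hc'o hmap' hκ0 hκt g₀ H hH₁, hΛ'eq]
  congr 1
  -- LIE HALF: pointwise `ρ g₀ · c(Y) = z · cayley (φ₀ Y)` on `Λ k`, then ★ FILE 2′ (d)
  obtain ⟨-, -, -, hd⟩ := hchart k hk₁
  have hstep : ∫⁻ Y in (Λ k : Set 𝔲), H (((ρ g₀ : GL m K) : Matrix m m K) * cayley ((𝔲.subtype : 𝔲 →+ Matrix m m K) Y)) ∂μ =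
      ∫⁻ Y in (Λ k : Set 𝔲), (fun s : 𝔲 => H (z • cayley (X₀ + (s : Matrix m m K))))
        ((fun s : 𝔲 => (⟨φ₀ (0 + s) - φ₀ 0, hφS s⟩ : 𝔲)) (0 + Y)) ∂μ := by
    refine setLIntegral_congr_fun (hΛo k).measurableSet fun Y hY => ?_
    obtain ⟨hB, hY1, -, -⟩ := hgoodk hY
    simp only [zero_add, AddSubgroup.coe_subtype, hφ₀0, add_sub_cancel]
    rw [hg₀, Matrix.smul_mul, cayley_mul_cayley_eq_cayley hm hY1 hB, hφ₀good _ hB hY1]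
  rw [hstep, hd _ hH₂]
  refine setLIntegral_congr_fun (hΛo k).measurableSet fun Y _ => ?_
  simp only [zero_add, AddSubgroup.coe_add, ZeroMemClass.coe_zero, hφ₀0, sub_self]
  rfl

end Assembly

end Summit.HodgeConjecture.HodgeConjecture.Cruxes.H413.F0P3cStCharTSHCDCayleyChartAt
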